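import Summits.QuantumFields.QCD.Theorems.HeatSlicedQuarksRobustYangMillsHandoverTransferLevelsMassContinuity

/-!
# The barrier argument: the spectral-response stub reduces to a sigma-term (a-priori Lipschitz) bound
(crux `HeatSlicedQuarks.RobustYangMillsHandover`, item stmt-QuantumFields-8892, line `pin-the-infimum`;
mechanism step (iii) of the held stub `stub_spectralResponse`, and the reduction of that stub to its step (i))

The held stub of the line asserts, for X₀'s regularisation: for every rate `ε > 0` some `δ > 0` such that eventually
in `k`, on every torus `2S+1 ≥ 2L_k+1`, a finite-volume transfer-matrix gap `≥ ε a_k` at one degenerate offset `μ`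
forces the gap `≥ (ε/2) a_k` at every degenerate offset of `[μ − δ, μ]`.  Its card decomposes the claim into
(i) an a-priori bound `|∂_μ g_{k,S}| ≤ a_k F(ε)` wherever `g_{k,S} ≥ (ε/2) a_k` (the renormalised sigma term of the
low-lying states), (ii) continuity of the min–max levels in the bare mass at fixed `(k, S)`, (iii) a barrier argument.
Step (ii) is now a theorem (`qcdTransferGap_continuousOn_mass`, previous file).  This file proves step (iii) as a
"continuous induction" lemma on a closed interval (`lowerBound_of_local_lipschitz`) and assembles (ii) + (iii) into

  `spectralResponse_of_sigmaTermBound` : (i) ⇒ the spectral-response statement,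

for EVERY regularisation (no X₀ data are needed for the implication).  What remains of the bet is exactly (i), the
volume-uniform sigma-term bound — stated in the skeleton as `stub_sigmaTermBound` (gen 3).

References: M. Reed, B. Simon, *Methods of Modern Mathematical Physics IV*, Thm XIII.1 [ReedSimonIV1978];
M. Lüscher, Commun. Math. Phys. 54 (1977) 283 [Luscher1977, pp. 283–292].  Pure theorem file.
-/

noncomputable section

namespace Summit.QuantumFields.QCD.Cruxes.RobustYangMillsHandover.PinTheInfimum

open scoped Topology
open Filter Set Literature.MathematicalPhysics.QuantumFieldTheory

namespace SpectralResponseBarrier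

/-! ### Step (iii): a lower bound propagates to the left under a local one-sided Lipschitz bound -/

/-- **The barrier argument (continuous induction on a closed interval).**  Let `g` be continuous on `[μ − δ, μ]` with
`g(μ) ≥ 2T`, and suppose that wherever `g(x) ≥ T` the function cannot drop faster than slope `L ≥ 0` over the next
stretch of length `≤ ρ` to the LEFT: `g(x') ≥ g(x) − L (x − x')` for `x' ≤ x`, `x − x' ≤ ρ`.  If `L δ ≤ T` then
`g ≥ T` on the whole interval (indeed `g(x) ≥ 2T − L(μ − x)`). [folklore] -/
theorem lowerBound_of_local_lipschitz {g : ℝ → ℝ} {μ δ ρ T L : ℝ} (hρ : 0 < ρ) (hL : 0 ≤ L)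
    (hδL : L * δ ≤ T) (hcont : ContinuousOn g (Icc (μ - δ) μ)) (hstart : 2 * T ≤ g μ)
    (hlip : ∀ x ∈ Icc (μ - δ) μ, ∀ x' ∈ Icc (μ - δ) μ, x' ≤ x → x - x' ≤ ρ → T ≤ g x → g x - L * (x - x') ≤ g x') :
    ∀ x ∈ Icc (μ - δ) μ, T ≤ g x := by
  -- reflect: `y = -x` runs from `-μ` to `δ - μ`; the claim `2T - L(μ + y) ≤ g(-y)` propagates to the right
  set s : Set ℝ := {y | 2 * T - L * (μ + y) ≤ g (-y)} with hs
  have hmaps : MapsTo (fun y : ℝ => -y) (Icc (-μ) (δ - μ)) (Icc (μ - δ) μ) := by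
    intro y hy
    simp only [mem_Icc] at hy ⊢
    constructor <;> linarith [hy.1, hy.2]
  have hcont' : ContinuousOn (fun y : ℝ => g (-y) - (2 * T - L * (μ + y))) (Icc (-μ) (δ - μ)) :=
    (hcont.comp continuous_neg.continuousOn hmaps).sub (by fun_prop)
  have hclosed : IsClosed (s ∩ Icc (-μ) (δ - μ)) := by
    have h := hcont'.preimage_isClosed_of_isClosed isClosed_Icc (isClosed_Ici (a := (0 : ℝ)))
    have e : Icc (-μ) (δ - μ) ∩ (fun y : ℝ => g (-y) - (2 * T - L * (μ + y))) ⁻¹' Ici 0 = s ∩ Icc (-μ) (δ - μ) := by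
      ext y
      simp only [mem_inter_iff, mem_preimage, mem_Ici, hs, mem_setOf_eq, sub_nonneg]
      tauto
    rwa [e] at h
  have hstart' : -μ ∈ s := by
    show 2 * T - L * (μ + -μ) ≤ g (- -μ)
    rw [add_neg_cancel, mul_zero, sub_zero, neg_neg]
    exact hstart
  have hstep : ∀ y ∈ s ∩ Ico (-μ) (δ - μ), s ∈ 𝓝[>] y := by
    rintro y ⟨hy, hyI⟩
    rw [mem_nhdsGT_iff_exists_Ioo_subset]
    refine ⟨min (y + ρ) (δ - μ), lt_min (by linarith) hyI.2, fun y' hy' => ?_⟩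
    simp only [mem_Ioo, lt_min_iff] at hy'
    obtain ⟨hyy', hy'ρ, hy'δ⟩ := hy'
    -- at `x = -y` the threshold `T` holds, so the one-sided Lipschitz bound reaches `x' = -y'`
    have hx : -y ∈ Icc (μ - δ) μ := hmaps ⟨hyI.1, hyI.2.le⟩
    have hx' : -y' ∈ Icc (μ - δ) μ := hmaps ⟨by linarith [hyI.1], hy'δ.le⟩
    have hgx : 2 * T - L * (μ + y) ≤ g (-y) := hy
    have hTx : T ≤ g (-y) := by
      have h1 : L * (μ + y) ≤ L * δ := mul_le_mul_of_nonneg_left (by linarith [hyI.2]) hL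
      linarith
    have h := hlip (-y) hx (-y') hx' (by linarith) (by linarith) hTx
    show 2 * T - L * (μ + y') ≤ g (-y')
    have e : -y - -y' = y' - y := by ring
    rw [e] at h
    nlinarith [h, hgx, hL]
  have hsub := hclosed.Icc_subset_of_forall_mem_nhdsWithin hstart' hstep
  intro x hx
  have hy : -x ∈ Icc (-μ) (δ - μ) := by
    simp only [mem_Icc] at hx ⊢
    constructor <;> linarith [hx.1, hx.2]
  have h : 2 * T - L * (μ + -x) ≤ g (- -x) := hsub hy
  rw [neg_neg] at h
  have h1 : L * (μ + -x) ≤ L * δ := mul_le_mul_of_nonneg_left (by simp only [mem_Icc] at hx; linarith [hx.1]) hL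
  linarith

/-! ### Step (ii) on the degenerate ray: continuity of the finite-volume gap in the common offset -/

/-- The bare trajectory at the degenerate offset `ν` is affine, hence continuous, in `ν`. [folklore] -/
theorem continuous_mq_diag {Nf : ℕ} (reg : QCDRegularisation Nf) (k : ℕ) :
    Continuous fun ν : ℝ => fun f : Fin Nf => (reg.scheme (fun _ => ν) 0 0).mq f k := by
  refine continuous_pi fun f => ?_
  simp only [QCDRegularisation.scheme_mq]
  fun_prop

/-- The bare masses at degenerate offsets are monotone in the offset (`a_k/Z_m(k) > 0`). [folklore] -/
theorem mq_diag_mono {Nf : ℕ} (reg : QCDRegularisation Nf) (k : ℕ) {ν ν' : ℝ} (h : ν' ≤ ν) (f : Fin Nf) :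
    (reg.scheme (fun _ => ν') 0 0).mq f k ≤ (reg.scheme (fun _ => ν) 0 0).mq f k := by
  simp only [QCDRegularisation.scheme_mq]
  have : reg.a k * ν' / reg.Zm k ≤ reg.a k * ν / reg.Zm k :=
    div_le_div_of_nonneg_right (mul_le_mul_of_nonneg_left h (reg.a_pos k).le) (reg.Zm_pos k).le
  linarith

/-- **The finite-volume transfer gap is continuous in the common offset on every interval above a range-guarded point**
(`qcdTransferGap_continuousOn_mass` composed with the affine bare trajectory). [cite: ReedSimonIV1978, Thm XIII.1] -/
theorem continuousOn_gap_diag {Nf : ℕ} [NeZero Nf] (reg : QCDRegularisation Nf) (k S : ℕ) (hβ : 0 ≤ reg.β k) {a b : ℝ}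
    (hguard : ∀ f, -1 < (reg.scheme (fun _ => a) 0 0).mq f k) :
    ContinuousOn (fun ν : ℝ => qcdTransferGap Nf (reg.β k) (2 * S + 1) (fun f => (reg.scheme (fun _ => ν) 0 0).mq f k))
      (Icc a b) := by
  have h := qcdTransferGap_continuousOn_mass Nf (2 * S + 1) (reg.β k) hβ
  refine h.comp (continuous_mq_diag reg k).continuousOn fun ν hν f => ?_
  exact lt_of_lt_of_le (hguard f) (mq_diag_mono reg k hν.1 f)

end SpectralResponseBarrier

/-- **The spectral-response statement follows from the sigma-term bound** (registered sub-goal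
`spectralResponse_of_sigmaTermBound` of crux stmt-QuantumFields-8892, line `pin-the-infimum`; mechanism steps (ii)+(iii)
of the held stub, for EVERY regularisation): if for every rate `ε > 0` there are `F, ρ > 0` such that eventually in `k`,
on every torus `2S+1 ≥ 2L_k+1`, lowering the common renormalised offset by `Δ ≤ ρ` from a range-guarded degenerate point
whose transfer gap is `≥ (ε/2) a_k` costs at most `a_k F Δ` of gap (the a-priori sigma-term bound), then a gap `≥ ε a_k` at
one degenerate offset `μ` forces the gap `≥ (ε/2) a_k` on `[μ − δ, μ]` with `δ = ε/(2F)` (continuity of the gap in the offset,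
`qcdTransferGap_continuousOn_mass`, plus the barrier lemma). [cite: ReedSimonIV1978, Thm XIII.1] [cite: Luscher1977, pp. 283–292] -/
theorem spectralResponse_of_sigmaTermBound : ∀ Nf : ℕ, Nf = 2 ∨ Nf = 3 → ∀ reg : QCDRegularisation Nf, (∀ ε > (0 : ℝ), ∃ F > (0 : ℝ), ∃ ρ > (0 : ℝ), ∀ᶠ k in atTop, ∀ S : ℕ, reg.L k ≤ S → ∀ ν ν' : ℝ, 0 ≤ reg.β k → (∀ f, -1 < (reg.scheme (fun _ => ν') 0 0).mq f k) → ν' ≤ ν → ν - ν' ≤ ρ → ε / 2 * reg.a k ≤ qcdTransferGap Nf (reg.β k) (2 * S + 1) (fun f => (reg.scheme (fun _ => ν) 0 0).mq f k) → qcdTransferGap Nf (reg.β k) (2 * S + 1) (fun f => (reg.scheme (fun _ => ν) 0 0).mq f k) - reg.a k * F * (ν - ν') ≤ qcdTransferGap Nf (reg.β k) (2 * S + 1) (fun f => (reg.scheme (fun _ => ν') 0 0).mq f k)) → ∀ ε > (0 : ℝ), ∃ δ > (0 : ℝ), ∀ᶠ k in atTop, ∀ S : ℕ, reg.L k ≤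 S → ∀ μ : ℝ, 0 ≤ reg.β k → (∀ f, -1 < (reg.scheme (fun _ => μ - δ) 0 0).mq f k) → ε * reg.a k ≤ qcdTransferGap Nf (reg.β k) (2 * S + 1) (fun f => (reg.scheme (fun _ => μ) 0 0).mq f k) → ∀ ν ∈ Set.Icc (μ - δ) μ, ε / 2 * reg.a k ≤ qcdTransferGap Nf (reg.β k) (2 * S + 1) (fun f => (reg.scheme (fun _ => ν) 0 0).mq f k) := by
  intro Nf hNf reg hsigma ε hε
  haveI : NeZero Nf := ⟨by rcases hNf with rfl | rfl <;> norm_num⟩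
  obtain ⟨F, hF, ρ, hρ, hev⟩ := hsigma ε hε
  refine ⟨ε / (2 * F), by positivity, ?_⟩
  filter_upwards [hev] with k hk S hS μ hβ hguard hstart ν hν
  -- the gap along the degenerate ray at step `k`, torus `2S+1`
  set g : ℝ → ℝ := fun ν => qcdTransferGap Nf (reg.β k) (2 * S + 1) (fun f => (reg.scheme (fun _ => ν) 0 0).mq f k)
    with hg
  have hcont : ContinuousOn g (Icc (μ - ε / (2 * F)) μ) :=
    SpectralResponseBarrier.continuousOn_gap_diag reg k S hβ hguard
  have hδL : reg.a k * F * (ε / (2 * F)) ≤ ε / 2 * reg.a k := by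
    have e : reg.a k * F * (ε / (2 * F)) = ε / 2 * reg.a k := by field_simp
    rw [e]
  have hstart' : 2 * (ε / 2 * reg.a k) ≤ g μ := by
    have e : 2 * (ε / 2 * reg.a k) = ε * reg.a k := by ring
    rw [e]; exact hstart
  refine SpectralResponseBarrier.lowerBound_of_local_lipschitz (g := g) hρ
    (mul_nonneg (reg.a_pos k).le hF.le) hδL hcont hstart' ?_ ν hν
  intro x hx x' hx' hxx' hρ' hTx
  have hguard' : ∀ f, -1 < (reg.scheme (fun _ => x') 0 0).mq f k := fun f =>
    lt_of_lt_of_le (hguard f) (SpectralResponseBarrier.mq_diag_mono reg k hx'.1 f)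
  exact hk S hS x x' hβ hguard' hxx' hρ' hTx

end Summit.QuantumFields.QCD.Cruxes.RobustYangMillsHandover.PinTheInfimum

end
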